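import Summits.MatrixMultiplication.OmegaCensus.ThreeSetZ5Z5CoverKit
import HarnessLib

/-!
# Margin-pruned kernel enumeration on `ZMod p × ZMod p`, BOTH margins: the column-capacity row enumerator

ω-census `pub-omega`, family (b3), seat pub-omega-group gen 36.  Framing: lottery ticket; floor = certified bounds/negative
ranges.  VALUE: a ≈ 10× cheaper kernel program for the three-set `ℤ₅²` covers (`ThreeSetZ5Z5Cover6*.lean`): the row
enumerator of `ZpZpDomino.coverGen` (gen 20) draws the rows independently, so a flagged row-sum vector costs
`Π_t C(R_t + p − 1, p − 1)` leaves; here the COLUMN-sum vector `C` (direction `1`, tagged code `off p B 1 + polyBE B C`) is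
chosen first as well and the rows are drawn from the compositions bounded above by the remaining column capacities
(`compsUB`), so only the matrices with both margins flagged are visited (`p = 5`, `d = 6`: 118 411 leaves in all instead of
1 253 125; Python twin `pub-omega-group-g36/code/emulate3c.py`).  NOT progress on ω.

* `compsUB cap r` / `mem_compsUB` — all lists bounded above pointwise by `cap` with sum `r` (complete);
* `rowsEnumC` / `rowsEnumC_spec` — rows with prescribed sums and column capacities; a leaf passes if some accumulated code is
  unflagged; `coverGenC` / `coverGenC_spec`;
* `cover3C p d tree` and **`exists_unflagged_of_cover3C`**, **`exists_cert_of_cover3C`** — the same conclusions as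
  `exists_unflagged_of_cover3` / `exists_cert_of_cover3` (`ThreeSetZ5Z5CoverKit.lean`) from the cheaper program.
Nothing about `tree` is trusted.
-/

namespace Summit.MatrixMultiplication.OmegaCensus

open Finset

namespace ZpZpDomino

/-! ## Compositions bounded above -/

/-- All lists `l` with `l.length = cap.length`, `l.sum = r` and `l[k] ≤ cap[k]`. [folklore] -/
def compsUB : List ℕ → ℕ → List (List ℕ)
  | [], r => if r = 0 then [[]] else []
  | c :: cap, r => (List.range (min c r + 1)).flatMap fun a => (compsUB cap (r - a)).map fun l => a :: l

/-- **Completeness of `compsUB`.** [folklore] -/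
theorem mem_compsUB : ∀ (cap : List ℕ) (r : ℕ) (l : List ℕ), l.length = cap.length → l.sum = r →
    (∀ k < cap.length, l.getD k 0 ≤ cap.getD k 0) → l ∈ compsUB cap r
  | [], r, l, hl, hs, _ => by
    have hl' : l = [] := List.eq_nil_of_length_eq_zero hl
    subst hl'
    simp only [List.sum_nil] at hs
    subst hs
    simp [compsUB]
  | c :: cap, r, l, hl, hs, hb => by
    obtain ⟨a, l', rfl⟩ := List.exists_cons_of_length_eq_add_one hl
    simp only [List.length_cons, Nat.add_right_cancel_iff] at hl
    simp only [List.sum_cons] at hs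
    have h0 := hb 0 (by simp)
    simp only [List.getD_cons_zero] at h0
    simp only [compsUB, List.mem_flatMap, List.mem_range, List.mem_map]
    refine ⟨a, by omega, l', ?_, rfl⟩
    refine mem_compsUB cap (r - a) l' hl (by omega) fun k hk => ?_
    simpa using hb (k + 1) (by simpa using hk)

/-- Remaining column capacities after placing a row: pointwise truncated subtraction. [folklore] -/
def subCap (cap row : List ℕ) : List ℕ := List.zipWith (fun c x => c - x) cap row

/-- Length of `subCap`. [folklore] -/
theorem length_subCap (cap row : List ℕ) (h : row.length = cap.length) : (subCap cap row).length = cap.length := by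
  simp [subCap, List.length_zipWith, h]

/-- Entries of `subCap`. [folklore] -/
theorem getD_subCap (cap row : List ℕ) (h : row.length = cap.length) {k : ℕ} (hk : k < cap.length) :
    (subCap cap row).getD k 0 = cap.getD k 0 - row.getD k 0 := by
  have hk' : k < row.length := by rw [h]; exact hk
  simp [subCap, List.getD_eq_getElem?_getD, List.getElem?_zipWith, List.getElem?_eq_getElem hk,
    List.getElem?_eq_getElem hk']

/-! ## The column-capacity row enumerator -/

/-- Rows with prescribed sums `R`, drawn from the compositions bounded by the remaining column capacities; a leaf passes
if some accumulated code is NOT flagged by `tree`. [folklore] -/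
def rowsEnumC (tree : BTree) : List (List (List ℕ)) → List ℕ → List ℕ → List ℕ → Bool
  | w :: ws, r :: R, cap, accs =>
      (compsUB cap r).all fun row => rowsEnumC tree ws R (subCap cap row) (addRow w accs row)
  | _, _, _, accs => accs.any fun a => !(tree.mem a)

/-- **Specification of the column-capacity row enumerator**: every matrix with row sums `R`, rows of length
`cap.length` and column sums bounded by `cap` reaches a passing leaf. [folklore] -/
theorem rowsEnumC_spec (tree : BTree) : ∀ (ws : List (List (List ℕ))) (R cap accs : List ℕ),
    rowsEnumC tree ws R cap accs = true → ws.length = R.length →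
    ∀ M : List (List ℕ), M.length = R.length →
    (∀ t < R.length, (M.getD t []).length = cap.length ∧ (M.getD t []).sum = R.getD t 0) →
    (∀ k < cap.length, (∑ t ∈ range R.length, (M.getD t []).getD k 0) ≤ cap.getD k 0) →
    (accsAfter ws accs M).any (fun a => !(tree.mem a)) = true
  | [], [], cap, accs, h, _, M, hM, _, _ => by
    have hM' : M = [] := List.eq_nil_of_length_eq_zero hM
    subst hM'
    simpa [rowsEnumC, accsAfter] using h
  | [], _ :: _, _, _, _, hl, _, _, _, _ => by simp at hl
  | _ :: _, [], _, _, _, hl, _, _, _, _ => by simp at hl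
  | w :: ws, r :: R, cap, accs, h, hl, M, hM, hrows, hcols => by
    obtain ⟨row, M', rfl⟩ := List.exists_cons_of_length_eq_add_one hM
    simp only [rowsEnumC, List.all_eq_true] at h
    simp only [List.length_cons, Nat.add_right_cancel_iff] at hl hM
    have h0 := hrows 0 (by simp)
    simp only [List.getD_cons_zero] at h0
    -- the first row is bounded by the capacities
    have hrowcap : ∀ k < cap.length, row.getD k 0 ≤ cap.getD k 0 := fun k hk => by
      have hc := hcols k hk
      rw [List.length_cons, sum_range_succ'] at hc
      simp only [List.getD_cons_zero, List.getD_cons_succ] at hc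
      omega
    have hmem : row ∈ compsUB cap r := mem_compsUB cap r row h0.1 h0.2 hrowcap
    simp only [accsAfter]
    refine rowsEnumC_spec tree ws R (subCap cap row) _ (h row hmem) hl M' hM (fun t ht => ?_) (fun k hk => ?_)
    · have h1 := hrows (t + 1) (by simpa using ht)
      simp only [List.getD_cons_succ] at h1
      rw [length_subCap _ _ h0.1]
      exact h1
    · rw [length_subCap _ _ h0.1] at hk
      rw [getD_subCap _ _ h0.1 hk]
      have hc := hcols k hk
      rw [List.length_cons, sum_range_succ'] at hc
      simp only [List.getD_cons_zero, List.getD_cons_succ] at hc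
      omega

/-- **The two-margin cover program**: for every candidate row-sum vector `R` and column-sum vector `C`, either the code of
`R` or the tagged code `offC + polyBE B C` is unflagged, or the column-capacity enumeration passes. [folklore] -/
def coverGenC (tree : BTree) (B : ℕ) (ws : List (List (List ℕ))) (Rlist Clist : List (List ℕ)) (init : List ℕ)
    (offC : ℕ) : Bool :=
  Rlist.all fun R => !(tree.mem (polyBE B R)) ||
    Clist.all fun C => !(tree.mem (offC + polyBE B C)) || rowsEnumC tree ws R C init

/-- **Specification of the two-margin cover program.** [folklore] -/
theorem coverGenC_spec {tree : BTree} {B : ℕ} {ws : List (List (List ℕ))} {Rlist Clist : List (List ℕ)} {init : List ℕ}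
    {offC : ℕ} (h : coverGenC tree B ws Rlist Clist init offC = true) (R : List ℕ) (hR : R ∈ Rlist)
    (hRl : ws.length = R.length) (C : List ℕ) (hC : C ∈ Clist) :
    tree.mem (polyBE B R) = false ∨ tree.mem (offC + polyBE B C) = false ∨
      ∀ M : List (List ℕ), M.length = R.length →
        (∀ t < R.length, (M.getD t []).length = C.length ∧ (M.getD t []).sum = R.getD t 0) →
        (∀ k < C.length, (∑ t ∈ range R.length, (M.getD t []).getD k 0) ≤ C.getD k 0) →
        (accsAfter ws init M).any (fun a => !(tree.mem a)) = true := by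
  simp only [coverGenC, List.all_eq_true] at h
  have hR' := h R hR
  rcases Bool.or_eq_true_iff.1 hR' with h1 | h2
  · left; simpa using h1
  · rw [List.all_eq_true] at h2
    rcases Bool.or_eq_true_iff.1 (h2 C hC) with h3 | h4
    · right; left; simpa using h3
    · right; right
      exact rowsEnumC_spec tree ws R C init h4 hRl

/-- **The two-margin three-set cover program**: row sums `R` (direction `0`) and column sums `C` (direction `1`, tagged by
`off p (d+1) 1`) over all compositions of `d`. [folklore] -/
def cover3C (p d : ℕ) (tree : BTree) : Bool :=
  coverGenC tree (d + 1) (rowWs p (d + 1)) (compsLB [] p d) (compsLB [] p d) (offs p (d + 1)) (off p (d + 1) 1)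

/-! ## Semantics -/

section Semantic

variable {p : ℕ} [NeZero p]

omit [NeZero p] in
/-- Direction `1` is the column index: `pv p 1 (cell t u) = u`. [folklore] -/
theorem pv_one_cell (t u : Fin p) : pv p 1 (cell t u).val = u.val := by
  have h1 : dirFst 1 = 0 := by decide
  have h2 : dirSnd 1 = 1 := by decide
  rw [cell_val, pv, h1, h2, zero_mul, zero_add, one_mul, show t.val * p + u.val = u.val + t.val * p by ring,
    Nat.add_mul_mod_self_right, Nat.mod_mod, Nat.mod_eq_of_lt u.isLt]

omit [NeZero p] in
/-- The count vector of direction `1` is the column-sum vector. [folklore] -/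
theorem sum_pick_one (g : Fin (p * p) → ℕ) (k : Fin p) :
    ∑ i, pick k.val (pv p 1 i.val) (g i) = ∑ t : Fin p, g (cell t k) := by
  rw [sum_eq_sum_cell]
  refine Fintype.sum_congr _ _ fun t => ?_
  have key : ∀ u : Fin p, pick k.val (pv p 1 (cell t u).val) (g (cell t u)) = if u = k then g (cell t u) else 0 := by
    intro u
    rw [pv_one_cell]
    unfold pick
    by_cases hu : u = k
    · rw [if_pos (by rw [hu]), if_pos hu]
    · rw [if_neg (fun e => hu (Fin.ext e)), if_neg hu]
  rw [Fintype.sum_congr _ _ key, Finset.sum_ite_eq' univ k, if_pos (mem_univ _)]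

/-- **From the two-margin cover program to an unflagged tagged code.** [folklore] -/
theorem exists_unflagged_of_cover3C {d : ℕ} (tree : BTree) (h : cover3C p d tree = true)
    (g : Fin (p * p) → ℕ) (hg : ∑ i, g i = d) :
    ∃ j < p + 1, tree.mem (off p (d + 1) j + polyBE (d + 1) (cnts p j g)) = false := by
  have hp0 : 0 < p := Nat.pos_of_ne_zero (NeZero.ne p)
  have hRlen : (rowSums g).length = p := length_rowSums g
  have hRsum : (rowSums g).sum = d := by rw [sum_rowSums, hg]
  have hRmem : rowSums g ∈ compsLB [] p d := mem_compsLB [] p d _ hRlen hRsum fun k _ => by simp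
  have hCmem : cnts p 1 g ∈ compsLB [] p d := hg ▸ cnts_mem_compsLB 1 g
  rcases coverGenC_spec h _ hRmem (by rw [length_rowWs, hRlen]) _ hCmem with hR | hC | hM
  · exact ⟨0, by omega, by rw [cnts_zero_eq_rowSums, off_zero, zero_add]; exact hR⟩
  · exact ⟨1, by omega, hC⟩
  · have hrows : ∀ t < (rowSums g).length,
        ((rowsOf g).getD t []).length = (cnts p 1 g).length ∧ ((rowsOf g).getD t []).sum = (rowSums g).getD t 0 := by
      intro t ht
      rw [hRlen] at ht
      rw [getD_rowsOf g ht, length_cnts, List.length_ofFn, List.sum_ofFn, getD_rowSums g ht]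
      exact ⟨rfl, rfl⟩
    have hcols : ∀ k < (cnts p 1 g).length,
        (∑ t ∈ range (rowSums g).length, ((rowsOf g).getD t []).getD k 0) ≤ (cnts p 1 g).getD k 0 := by
      intro k hk
      rw [length_cnts] at hk
      rw [hRlen, getD_cnts 1 g hk, sum_range, sum_pick_one g ⟨k, hk⟩]
      refine le_of_eq (Fintype.sum_congr _ _ fun t => ?_)
      rw [getD_rowsOf g t.isLt, Literature.Computability.Complexity.getD_ofFn _ _ hk]
    have hany := hM (rowsOf g) (by rw [length_rowsOf, hRlen]) hrows hcols
    rw [List.any_eq_true] at hany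
    obtain ⟨a, ha, hfa⟩ := hany
    obtain ⟨j, hj, rfl⟩ := List.getElem_of_mem ha
    have hws : ∀ w ∈ rowWs p (d + 1), ∀ x ∈ w, x.length = (offs p (d + 1)).length := by
      intro w hw x hx
      simp only [rowWs, List.mem_map, List.mem_range] at hw
      obtain ⟨t, -, rfl⟩ := hw
      simp only [rowW, List.mem_map, List.mem_range] at hx
      obtain ⟨u, -, rfl⟩ := hx
      simp
    have hlen : (accsAfter (rowWs p (d + 1)) (offs p (d + 1)) (rowsOf g)).length = p + 1 := by
      rw [length_accsAfter _ _ _ hws, length_offs]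
    have hj' : j < p + 1 := by rw [← hlen]; exact hj
    refine ⟨j, hj', ?_⟩
    have e := getD_accsAfter_rowsOf_init (d + 1) g (offs p (d + 1)) (length_offs _ _) hj'
    rw [List.getD_eq_getElem _ _ hj, getD_offs _ _ hj', code_eq_polyBE] at e
    rw [← e]
    simpa using hfa

/-- **From the two-margin cover program and the soundness check to a certified direction.** [folklore] -/
theorem exists_cert_of_cover3C {d : ℕ} (tree : BTree) (cert : ℕ → List ℕ → Bool)
    (hs : soundChk3 p d tree cert = true) (h : cover3C p d tree = true)
    (g : Fin (p * p) → ℕ) (hg : ∑ i, g i = d) :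
    ∃ j < p + 1, cert j (cnts p j g) = true := by
  obtain ⟨j, hj, hmem⟩ := exists_unflagged_of_cover3C tree h g hg
  refine ⟨j, hj, ?_⟩
  simp only [soundChk3, List.all_eq_true, List.mem_range] at hs
  have h1 := hs j hj (cnts p j g) (hg ▸ cnts_mem_compsLB j g)
  rw [hmem, Bool.false_or] at h1
  exact h1

end Semantic

end ZpZpDomino

end Summit.MatrixMultiplication.OmegaCensus
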